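import Literature.AlgebraicGeometry.Resolution.InseparableLocalUniformization
import Literature.AlgebraicGeometry.Resolution.NormalizationOfVarieties
import Literature.AlgebraicGeometry.Resolution.CompositeValuations
import HarnessLib

/-!
# Inseparable local uniformization: the descent theorem in height at most one (Thm. 4.1.1)

Topic: `Literature/AlgebraicGeometry/Resolution`. Companion to
`InseparableLocalUniformization.lean`, which vendors the corrected relative form
`Temkin2013Relative` of Temkin's Thm. 1.3.2 and reduces it (`Temkin2013Relative.of_height`) to
the two named facts `Temkin2013HeightLeOne` (Thm. 1.3.2 in height `≤ 1`) and
`Temkin2013HeightStep` (§4.2). All numbering and pages are those of the journal version =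
arXiv:0804.1554v3.

This file refines that top layer along the printed proof (§4):

* `Temkin2013Descent` — NAMED FACT, **Temkin 2013, Thm. 4.1.1 in the case `n = 1`** (Remark
  4.1.2: "The case of `n = 1` in Theorem 4.1.1 covers our needs"): DESCENT inseparable local
  uniformization in height `≤ 1` — for a NORMAL affine model `X` of `K°` and a finite extension
  of valued fields `K₁/K`, some affine refinement `X'` of `X` and finite purely inseparable `l/k`,
  `L/lK` make the centre of `(LK₁)°` on `Nr_{LK₁}(X')` a simple `l`-smooth point. The
  logarithmic part of the printed conclusion (the `Q`-Cartier divisor `D'` and log smoothness of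
  simplicial shape) is dropped, so the vendored statement is a consequence of the printed one.
  This descent form (with `K₁ ≠ K`) is what §4.2 invokes ("By Theorem 4.1.1 applied to `Y`, `k̄°`
  and `m°` (instead of `X`, `K°` and `K₁°` in the formulation of Theorem 4.1.1)", p. 51; cf.
  §5.1, p. 52: "we should establish in Theorem 4.1.1 a descent form of inseparable local
  uniformization").
* `Temkin2013Descent.heightLeOne` — PROVED: `Temkin2013Descent` and E. Noether's finiteness of
  integral closure (`NoetherFiniteIntegralClosure`, Liu 2002, Prop. 4.1.27, vendored in
  `NormalizationOfVarieties.lean`) imply `Temkin2013HeightLeOne`. This is the sentence "We will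
  establish the height one case of the Theorem in §4.1" (p. 46): apply Thm. 4.1.1 with `n = 1`,
  `K₁ = K` to the normalisation `Nr_K(X)`, which is a normal affine model of `K°` refining `X`
  (finite over `X` by Noether, inside `K°` because valuation rings are integrally closed).
* `Temkin2013HeightStepOfDescent` — NAMED FACT, §4.2 with its printed inputs: the descent
  theorem (Thm. 4.1.1, `n = 1`) AND Thm. 1.3.2 in height `≤ n` give Thm. 1.3.2 in height
  `≤ n + 1`. It is weaker than `Temkin2013HeightStep` (which omits the descent input;
  `Temkin2013HeightStep.heightStepOfDescent`) and closer to the printed argument, whose Step 2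
  applies Thm. 4.1.1 with `K₁ = m ≠ K` (Remark 4.1.3: this is why a descent form is proved).
* `Temkin2013Relative.of_descent`, `Temkin2013.of_descent` — PROVED assembly MODULO
  `(hF : NoetherFiniteIntegralClosure)`: `Temkin2013Descent → NoetherFiniteIntegralClosure →
  Temkin2013HeightStepOfDescent → Temkin2013Relative` (resp. `→ Temkin2013`). That the frontier
  of the corrected Thm. 1.3.2 is exactly `{Temkin2013Descent, Temkin2013HeightStepOfDescent}`
  (two results of the paper, by their own numbers) is established not here but in the roof
  module `InseparableLocalUniformizationProofs.lean` (`Temkin2013HeightLeOne.of_descent`,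
  `Temkin2013Relative.of_frontier`, `Temkin2013.of_frontier`, `temkin2013Relative_iff_frontier`),
  which imports this file and feeds `hF := NoetherFiniteIntegralClosure_holds`
  (`NormalizationOfVarietiesProofs.lean`) into the `hF`-parametrised theorems below; their
  signatures are kept for that module.
* Step 0 of both printed proofs, PROVED (`Temkin2013RelConclusion.of_purelyInseparable`,
  `.of_purelyInseparable_right`, `.of_le`; Thm. 4.1.1 Step 0, p. 47, and §4.2 Step 0, p. 50:
  "we can safely replace `k`, `K` and `X` with `l`, `L` and `X'`, where `l/k` and `L/lK` are
  finite and purely inseparable and `X'` is a model of `L°` that refines `Nr_L(X)`"): the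
  conclusion of the corrected Thm. 1.3.2 descends along finite purely inseparable extensions
  of the ground field and of the function field, and along refinements of the model. With it:
  uniqueness of the extension of a valuation ring in a purely inseparable extension
  (`valuationSubring_eq_of_comap_eq_of_isPurelyInseparable`; "the unique extension of `Kᵢ°`",
  Thm. 4.1.1), the order isomorphism between the overrings of `O_F` and of `O_F ∩ K`
  (`overringsOrderIsoOfIsPurelyInseparable`, inverse = the hull `comapHull` of
  `CompositeValuations.lean`) and invariance of the height
  (`ringKrullDim_eq_comap_of_isPurelyInseparable`, so that such replacements stay inside
  `Temkin2013RelHeightLE n`).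

Below Thm. 4.1.1 the printed proof (pp. 47–50) is an induction on the transcendence defect
(base: Abhyankar valuations, Thm. 5.5.2; step: fibration by curves, Thm. 3.3.1 via decompletion
of the Berkovich-analytic Thm. 3.2.6, Lemmas 2.8.4/2.8.5, Prop. 2.3.8), which needs notions
Mathlib does not have (height/transcendence defect of valued fields, nft schemes over valuation
rings, smooth-equivalence, Berkovich curves, log smoothness); it is not vendored here.

## Sources

* M. Temkin, *Inseparable local uniformization*, J. Algebra 373 (2013) 65–119 = arXiv:0804.1554v3:
  Thm. 1.3.2 and the conventions after it (pp. 3–4), §4 (p. 46), Thm. 4.1.1, Remark 4.1.2 and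
  Step 0 of its proof (p. 47), Remark 4.1.3 (p. 49), §4.2 (pp. 50–51), §5.1 (p. 52).
* Q. Liu, *Algebraic Geometry and Arithmetic Curves*, OUP 2002, Prop. 4.1.27 (finiteness of
  integral closure; vendored as `NoetherFiniteIntegralClosure`).

## Rendering notes

* As in `InseparableLocalUniformization.lean`: height `≤ 1` ↦ `ringKrullDim O ≤ 1`; "simple"
  ↦ `Algebra.FormallySmooth l k(𝔭)` (NOT `Algebra.IsSeparable`, see `not_temkin2013Rel`);
  the simple `l`-smooth centre on `Nr(X')` is rendered exactly as in `Temkin2013RelConclusion`.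
* "`X` is a normal affine `k`-model of `K`" (a model of the valued field `K`, i.e. of `K°`; cf.
  Step 0 of the proof, p. 47: "It suffices to prove the theorem for any affine model of `K°`
  which is finer than `X`") ↦ `A ⊆ K°` finitely generated over `k`, `Frac A = K`, and `A`
  integrally closed in `K` (`∀ x, IsIntegral A x → x ∈ A`).
* "`K₁/K` a finite extension of valued fields" ↦ a finite field extension `K₁` with a valuation
  ring `O₁` of `K₁` such that `O₁ ∩ K = K°`.
* "`L₁ = LK₁` with the unique extension of `K₁°`" ↦ a field `L₁ ⊇ K₁`, finite purely inseparable
  over `K₁`, an intermediate field `L` of `L₁/K` which is purely inseparable over `K`, contains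
  `l` and generates `L₁` over `K₁` (`Algebra.adjoin K₁ L = ⊤`), and a valuation ring `O₁'` of `L₁`
  with `O₁' ∩ K₁ = O₁` (THE one, by pure inseparability). "`l/k` and `L/lK` finite purely
  inseparable" ↦ `l` finite purely inseparable over `k`, `l ⊆ L`, `L/K` purely inseparable
  (finite automatically, inside the finite `L₁/K`).
-/

noncomputable section

open IsLocalRing

namespace Literature.AlgebraicGeometry.Resolution

universe u

/-! ### The descent theorem (Thm. 4.1.1, `n = 1`) -/

/-- NAMED FACT — **Temkin's descent inseparable local uniformization in height at most one**
(Temkin 2013, Thm. 4.1.1, p. 47: "Assume that `K/k` is a finitely generated extension of valued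
fields such that `k` is trivially valued and the height of `K` is [at] most one. Assume also
that `X` is a normal affine `k`-model of `K` and `K₁/K, …, K_n/K` are finite extensions of
valued fields. Given finite purely inseparable extensions `l/k` and `L/lK` and an affine model
`X'` of `K°` with a Q-Cartier divisor `D' ⊂ X'` containing the center of `K°` consider the
following objects: fields `Lᵢ = LKᵢ` with the unique extension of `Kᵢ°`, their models
`Xᵢ = Nr_{Lᵢ}(X')`, the preimages `Dᵢ ⊂ Xᵢ` of `D'` and the centers `xᵢ ∈ Xᵢ` of `Lᵢ°`. Then
there exists a choice of `l/k`, `L/lk`, `X'` and `D'` such that `X'` refines `X`, each `xᵢ` is a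
log smooth point of simplicial shape of the `l`-pair `(Xᵢ, Dᵢ)`, and `x₁` is even a simple
`l`-smooth point"; Remark 4.1.2: "The case of `n = 1` in Theorem 4.1.1 covers our needs"),
vendored in the case `n = 1` and WITHOUT the logarithmic data (`D'`, log smoothness), i.e. as a
consequence of the printed statement. Hypotheses, in order: `K/k` finitely generated;
`O = K° ⊇ k` with `ringKrullDim O ≤ 1`; `X = Spec A` an affine model of `K°` (`A ⊆ K°` finitely
generated over `k`, `Frac A = K`) which is normal; `K₁/K` finite (a `K`-algebra; no separate
`k`-structure on `K₁` is assumed, `k` acts through `K`) with a valuation ring `O₁ = K₁°` over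
`K°`. Conclusion: `L₁ = LK₁` finite purely inseparable over `K₁`; `l ≤ L ≤ L₁`
with `l/k` finite purely inseparable, `L/K` purely inseparable and `K₁[L] = L₁`; an affine
model `X' = Spec A'` of `K°` refining `X`; `O₁' = L₁°` over `K₁°`; and the centre `𝔭` of `L₁°`
on `N = Nr_{L₁}(X')` (an affine model of `L₁°`: finitely generated over `k`, `Frac N = L₁`) is
`l`-smooth (`Algebra.IsSmoothAt l 𝔭`), simple (`k(𝔭)/l` separable = `Algebra.FormallySmooth l
k(𝔭)`, Matsumura CRT Thm. 26.9) and regular. See the module docstring for the rendering.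
Users take `(h : Temkin2013Descent)`. [cite: Temkin2013, Thm. 4.1.1] -/
def Temkin2013Descent : Prop :=
  ∀ (k K : Type u) [Field k] [Field K] [Algebra k K], (⊤ : IntermediateField k K).FG →
    ∀ O : ValuationSubring K, (∀ c : k, algebraMap k K c ∈ O) → ringKrullDim O ≤ 1 →
    ∀ A : Subalgebra k K, A.toSubring ≤ O.toSubring → A.FG → IsFractionRing A K →
      (∀ x : K, IsIntegral A x → x ∈ A) →
    ∀ (K₁ : Type u) [Field K₁] [Algebra K K₁], FiniteDimensional K K₁ →
    ∀ O₁ : ValuationSubring K₁, O₁.comap (algebraMap K K₁) = O →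
      ∃ (L₁ : Type u) (_ : Field L₁) (_ : Algebra K₁ L₁) (_ : Algebra K L₁) (_ : Algebra k L₁)
        (_ : IsScalarTower K K₁ L₁) (_ : IsScalarTower k K L₁),
        FiniteDimensional K₁ L₁ ∧ IsPurelyInseparable K₁ L₁ ∧
        ∃ l : IntermediateField k L₁, FiniteDimensional k l ∧ IsPurelyInseparable k l ∧
        ∃ L : IntermediateField K L₁, (l : Set L₁) ⊆ (L : Set L₁) ∧ IsPurelyInseparable K L ∧
          Algebra.adjoin K₁ (L : Set L₁) = ⊤ ∧
        ∃ (A' : Subalgebra k K), A ≤ A' ∧ A'.toSubring ≤ O.toSubring ∧ A'.FG ∧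
          IsFractionRing A' K ∧
        ∃ O₁' : ValuationSubring L₁, O₁'.comap (algebraMap K₁ L₁) = O₁ ∧
        ∃ (N : Subalgebra l L₁) (hN : N.toSubring ≤ O₁'.toSubring),
          (N : Set L₁) = {x : L₁ | IsIntegral (A'.map (IsScalarTower.toAlgHom k K L₁)) x} ∧
          (N.restrictScalars k).FG ∧ IsFractionRing N L₁ ∧
          Algebra.IsSmoothAt l (centreIdeal N O₁' hN) ∧
          Algebra.FormallySmooth l
            (IsLocalRing.ResidueField (Localization.AtPrime (centreIdeal N O₁' hN))) ∧
          IsRegularLocalRing (Localization.AtPrime (centreIdeal N O₁' hN))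

/-- NAMED FACT — **Temkin's induction step on the height, with its printed inputs** (Temkin
2013, §4.2 "Induction on height", pp. 50–51: "Our proof runs by induction on the height `h` of
`K°`. Since the case of `h ≤ 1` was established earlier, we should establish the step of the
induction. So, we assume that the statement of the theorem holds true for `K`'s of smaller
height"; Step 1 applies the induction assumption to "the `k̄`-variety `X_η` and the valued field
`F`" of height `h - 1`; Step 2: "By Theorem 4.1.1 applied to `Y`, `k̄°` and `m°` (instead of `X`,
`K°` and `K₁°` in the formulation of Theorem 4.1.1), we find finite purely inseparable extensions
… This establishes induction on height in the proof of Theorem 1.3.2"). Rendered as the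
implication the section proves: the descent theorem in height `≤ 1` (Thm. 4.1.1 with `n = 1`,
`Temkin2013Descent`) and the corrected relative Thm. 1.3.2 for all valuation rings of height
`≤ n` (`n ≥ 1`) give it in height `≤ n + 1`. (The printed step also uses the paper's Lemma
3.3.2, Prop. 2.3.8 and Lemmas 2.8.4/2.8.5, which involve notions absent from Mathlib and are
part of what this fact packages.) Weaker than `Temkin2013HeightStep`, which omits the descent
input (`Temkin2013HeightStep.heightStepOfDescent`). Users take `(h : Temkin2013HeightStepOfDescent)`.
[cite: Temkin2013, Section 4.2 (arXiv:0804.1554v3 pp. 50–51)] -/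
def Temkin2013HeightStepOfDescent : Prop :=
  Temkin2013Descent.{u} →
    ∀ n : ℕ, 1 ≤ n → Temkin2013RelHeightLE.{u} n → Temkin2013RelHeightLE.{u} (n + 1)

/-- The step without the descent input trivially gives the step with it. [folklore] -/
theorem Temkin2013HeightStep.heightStepOfDescent (h : Temkin2013HeightStep.{u}) :
    Temkin2013HeightStepOfDescent.{u} :=
  fun _ => h

/-- Sanity check on strength: the corrected theorem itself implies the step (so vendoring the
step adds nothing beyond `Temkin2013Relative`). [folklore] -/
theorem Temkin2013Relative.heightStepOfDescent (h : Temkin2013Relative.{u}) :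
    Temkin2013HeightStepOfDescent.{u} :=
  fun _ n _ _ => h.heightLE (n + 1)

/-! ### Normalisation of an affine model -/

section normalisation

variable {k K : Type u} [Field k] [Field K] [Algebra k K]

/-- An element of `K` integral over a subalgebra `A ⊆ O` of a valuation ring `O` of `K` lies in `O`
(valuation rings are integrally closed). [folklore] -/
theorem mem_valuationSubring_of_isIntegral (O : ValuationSubring K) (A : Subalgebra k K)
    (hAO : A.toSubring ≤ O.toSubring) {x : K} (hx : IsIntegral A x) : x ∈ O := by
  letI : Algebra A O := (Subring.inclusion hAO).toAlgebra
  haveI : IsScalarTower A O K := IsScalarTower.of_algebraMap_eq (fun _ => rfl)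
  have hx' : IsIntegral O x := hx.tower_top
  obtain ⟨y, rfl⟩ := IsIntegrallyClosed.algebraMap_eq_of_integral hx'
  exact y.2

/-- **The normalisation of an affine model is an affine model** (E. Noether's finiteness of
integral closure, `NoetherFiniteIntegralClosure`, in the case `L = Frac A`; Temkin 2013, p. 4:
"`Nr_L(Spec A)` is the scheme `Spec(Nr_L(A))`", an `l`-variety): the integral closure in `K` of
a finitely generated `k`-subalgebra `A` with `Frac A = K` is (the underlying set of) a finitely
generated `k`-subalgebra of `K`. [folklore] -/
theorem exists_fg_integralClosure (hF : NoetherFiniteIntegralClosure.{u}) (A : Subalgebra k K)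
    (hAfg : A.FG) [IsFractionRing A K] :
    ∃ B : Subalgebra k K, (B : Set K) = {x : K | IsIntegral A x} ∧ B.FG := by
  haveI : Algebra.FiniteType k A := A.fg_iff_finiteType.mp hAfg
  haveI : Module.Finite A (integralClosure A K) := hF.self k A K
  have hft : Algebra.FiniteType k (integralClosure A K) :=
    Algebra.FiniteType.trans ‹Algebra.FiniteType k A› inferInstance
  exact ⟨(integralClosure A K).restrictScalars k, rfl,
    (Subalgebra.fg_iff_finiteType _).mpr hft⟩

/-- The normalisation `Nr_K(X)` of an affine model `X = Spec A` of a valuation ring `O` is a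
NORMAL affine model of `O` refining `X`: given Noether finiteness, there is a finitely generated
`k`-subalgebra `B` with `A ≤ B ⊆ O`, `Frac B = K`, underlying set the integral closure of `A`,
and `B` integrally closed in `K` (Temkin 2013, proof of Thm. 4.1.1, Step 0, p. 47: one may pass
to finer affine models, in particular to normal ones). [folklore] -/
theorem exists_normal_affineModel_ge (hF : NoetherFiniteIntegralClosure.{u})
    (O : ValuationSubring K) (A : Subalgebra k K) (hAO : A.toSubring ≤ O.toSubring)
    (hAfg : A.FG) (hAfr : IsFractionRing A K) :
    ∃ B : Subalgebra k K, A ≤ B ∧ B.toSubring ≤ O.toSubring ∧ B.FG ∧ IsFractionRing B K ∧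
      (∀ x : K, IsIntegral B x → x ∈ B) ∧ (B : Set K) = {x : K | IsIntegral A x} := by
  classical
  haveI : IsFractionRing A K := hAfr
  obtain ⟨B, hB, hBfg⟩ := exists_fg_integralClosure hF A hAfg
  have hmemB : ∀ x : K, x ∈ B ↔ IsIntegral A x := fun x => by
    rw [← SetLike.mem_coe, hB]; rfl
  have hAB : A ≤ B := fun x hx => (hmemB x).2 (isIntegral_algebraMap (x := (⟨x, hx⟩ : A)))
  have hBO : B.toSubring ≤ O.toSubring := fun x hx =>
    mem_valuationSubring_of_isIntegral O A hAO ((hmemB x).1 hx)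
  have hBfr : IsFractionRing B K := by
    refine IsFractionRing.of_field B K fun z => ?_
    obtain ⟨x, y, hy, rfl⟩ := IsFractionRing.div_surjective (A := A) z
    exact ⟨⟨x, hAB x.2⟩, ⟨y, hAB y.2⟩, rfl⟩
  have hBnorm : ∀ x : K, IsIntegral B x → x ∈ B := by
    intro x hx
    rw [hmemB]
    letI : Algebra A B := (Subalgebra.inclusion hAB).toRingHom.toAlgebra
    haveI : IsScalarTower A B K := IsScalarTower.of_algebraMap_eq (fun _ => rfl)
    haveI : Algebra.IsIntegral A B := by
      refine ⟨fun y => ?_⟩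
      have hy : IsIntegral A (y : K) := (hmemB y).1 y.2
      exact (isIntegral_algHom_iff (IsScalarTower.toAlgHom A B K) Subtype.val_injective).1 hy
    exact isIntegral_trans x hx
  exact ⟨B, hAB, hBO, hBfg, hBfr, hBnorm, hB⟩

end normalisation

/-! ### Height at most one from descent, and assembly -/

/-- **The height-one case from the descent theorem** (Temkin 2013, p. 46: "We will establish the
height one case of the Theorem in §4.1"; §4.2, p. 50: "the case of `h ≤ 1` was established
earlier"): Thm. 4.1.1 with `n = 1` and `K₁ = K` (valued by `K°` itself), applied to the
normalisation `Nr_K(X)` of the given affine model — a normal affine model of `K°` refining `X`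
by `exists_normal_affineModel_ge` — yields the corrected relative Thm. 1.3.2 for valuation
rings of height `≤ 1`; refinement is transitive (`A ≤ Nr_K(A) ≤ A'`). [folklore] -/
theorem Temkin2013Descent.heightLeOne (hD : Temkin2013Descent.{u})
    (hF : NoetherFiniteIntegralClosure.{u}) : Temkin2013HeightLeOne.{u} := by
  intro k K _ _ _ hfg O hO hdim A hAO hAfg hAfr
  classical
  -- the normalisation `B = Nr_K(A)`, a normal affine model of `O` refining `A`
  obtain ⟨B, hAB, hBO, hBfg, hBfr, hBnorm, -⟩ := exists_normal_affineModel_ge hF O A hAO hAfg hAfr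
  -- apply the descent theorem with `K₁ = K`, `K₁° = K°`
  have hOO : O.comap (algebraMap K K) = O := by ext x; simp
  obtain ⟨L₁, iF, iAK₁, iAK, iAk, iT₁, iT₂, hfin, hpi, l, hlfin, hlpi, L, -, -, -, A', hBA', hA'O,
    hA'fg, hA'fr, O₁', hO₁', N, hN, hNint, hNfg, hNfr, hsm, hsep, hreg⟩ :=
    hD k K hfg O hO hdim B hBO hBfg hBfr hBnorm K
      (inferInstance : FiniteDimensional K K) O hOO
  -- the two `K`-algebra structures on `L₁` (via `K₁ = K` and the direct one) coincide
  have hinst : iAK = iAK₁ := by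
    refine Algebra.algebra_ext _ _ fun r => ?_
    have := @IsScalarTower.algebraMap_apply K K L₁ _ _ _ _ iAK₁ iAK iT₁ r
    simpa using this
  subst hinst
  exact ⟨L₁, iF, iAK, iAk, iT₂, hfin, hpi, l, hlfin, hlpi, A', hAB.trans hBA', hA'O, hA'fg, hA'fr,
    O₁', hO₁', N, hN, hNint, hNfg, hNfr, hsm, hsep, hreg⟩

/-- **Assembly of Temkin's §4 from the printed DAG.** The corrected relative Thm. 1.3.2
(`Temkin2013Relative`) follows from the descent theorem in height `≤ 1` (Thm. 4.1.1, `n = 1`),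
E. Noether's finiteness of integral closure, and the induction step on the height (§4.2, with
the descent theorem as input); finiteness of the height is `Temkin2013Relative.of_height`. The
remaining inputs are thus `Temkin2013Descent`, `Temkin2013HeightStepOfDescent` and `hF`; the
latter is discharged in the tree (`NoetherFiniteIntegralClosure_holds`,
`NormalizationOfVarietiesProofs.lean`) and fed in by `Temkin2013Relative.of_frontier`
(`InseparableLocalUniformizationProofs.lean`), where the frontier becomes exactly
`{Temkin2013Descent, Temkin2013HeightStepOfDescent}`. [cite: Temkin2013, Section 4] -/
theorem Temkin2013Relative.of_descent (hD : Temkin2013Descent.{u})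
    (hF : NoetherFiniteIntegralClosure.{u}) (hs : Temkin2013HeightStepOfDescent.{u}) :
    Temkin2013Relative.{u} :=
  Temkin2013Relative.of_height (hD.heightLeOne hF) (hs hD)

/-- … and hence the weak absolute form `Temkin2013` used by the routes. [cite: Temkin2013, Thm. 1.3.2] -/
theorem Temkin2013.of_descent (hD : Temkin2013Descent.{u})
    (hF : NoetherFiniteIntegralClosure.{u}) (hs : Temkin2013HeightStepOfDescent.{u}) :
    Temkin2013.{u} :=
  (Temkin2013Relative.of_descent hD hF hs).temkin2013

/-- Modulo the descent theorem and Noether finiteness, the corrected relative Thm. 1.3.2 is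
EQUIVALENT to the induction step with its printed inputs. [folklore] -/
theorem temkin2013Relative_iff_heightStepOfDescent (hD : Temkin2013Descent.{u})
    (hF : NoetherFiniteIntegralClosure.{u}) :
    Temkin2013Relative.{u} ↔ Temkin2013HeightStepOfDescent.{u} :=
  ⟨Temkin2013Relative.heightStepOfDescent, Temkin2013Relative.of_descent hD hF⟩

/-! ### Step 0: purely inseparable extensions and refinements are harmless

Temkin 2013, proof of Thm. 4.1.1, Step 0 (p. 47) and §4.2, Step 0 (p. 50). Everything in this
section is PROVED. -/

section valuationPI

variable {K F : Type*} [Field K] [Field F] [Algebra K F]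

/-- A valuation ring contains every element a positive power of which it contains (it is
integrally closed). [folklore] -/
theorem mem_valuationSubring_of_pow_mem (O : ValuationSubring F) {x : F} {n : ℕ} (hn : 0 < n)
    (hx : x ^ n ∈ O) : x ∈ O := by
  have hint : IsIntegral O (x ^ n) := by
    have : x ^ n = algebraMap O F ⟨x ^ n, hx⟩ := rfl
    rw [this]
    exact isIntegral_algebraMap
  obtain ⟨y, hy⟩ := IsIntegrallyClosed.exists_algebraMap_eq_of_isIntegral_pow hn hint
  exact hy ▸ y.2

/-- In a purely inseparable extension, inclusion of valuation rings is detected on `K`.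
[folklore] -/
theorem valuationSubring_le_of_comap_le_of_isPurelyInseparable [IsPurelyInseparable K F]
    {O₁ O₂ : ValuationSubring F}
    (h : O₁.comap (algebraMap K F) ≤ O₂.comap (algebraMap K F)) : O₁ ≤ O₂ := by
  intro x hx
  obtain ⟨n, y, hy⟩ := IsPurelyInseparable.pow_mem K (ringExpChar K) x
  have hy₁ : y ∈ O₁.comap (algebraMap K F) := by
    rw [ValuationSubring.mem_comap, hy]; exact pow_mem hx _
  have hy₂ := h hy₁
  rw [ValuationSubring.mem_comap, hy] at hy₂
  exact mem_valuationSubring_of_pow_mem O₂ (expChar_pow_pos K _ n) hy₂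

/-- **Uniqueness of the extension of a valuation ring to a purely inseparable extension**
(Temkin 2013, Thm. 4.1.1: "fields `Lᵢ = LKᵢ` with the unique extension of `Kᵢ°`"; §4.2 Step 1:
"the valuation ring `Nr_L(F°)` (which is the only extension of `F°` to `L`)"): two valuation
rings of a purely inseparable extension `F/K` with the same trace on `K` coincide, since
`x ∈ O ↔ x^{qⁿ} ∈ O`. (Existence: `exists_valuationSubring_ge_comap_eq` below, or Chevalley's
theorem `exists_valuationSubring_comap_eq` in `SmoothUniformization.lean`.) [folklore] -/
theorem valuationSubring_eq_of_comap_eq_of_isPurelyInseparable [IsPurelyInseparable K F]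
    {O₁ O₂ : ValuationSubring F}
    (h : O₁.comap (algebraMap K F) = O₂.comap (algebraMap K F)) : O₁ = O₂ :=
  le_antisymm (valuationSubring_le_of_comap_le_of_isPurelyInseparable h.le)
    (valuationSubring_le_of_comap_le_of_isPurelyInseparable h.ge)

/-- **Overrings correspond in a purely inseparable extension**: restriction to `K` is an order
isomorphism from the overrings of a valuation ring `O_F` of `F` onto the overrings of
`O_F ∩ K` (inverse: the hull `comapHull` of `CompositeValuations.lean`; injectivity and order
reflection by `x ∈ S ↔ x^{qⁿ} ∈ S`). [folklore] -/
def overringsOrderIsoOfIsPurelyInseparable [IsPurelyInseparable K F] (O_F : ValuationSubring F) :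
    {S : ValuationSubring F // O_F ≤ S} ≃o
      {T : ValuationSubring K // O_F.comap (algebraMap K F) ≤ T} where
  toFun S := ⟨S.1.comap (algebraMap K F), fun _ hx => S.2 hx⟩
  invFun T := ⟨comapHull O_F (algebraMap K F) T.1, le_comapHull O_F (algebraMap K F) T.1⟩
  left_inv S := Subtype.ext <| valuationSubring_eq_of_comap_eq_of_isPurelyInseparable (K := K)
    (comap_comapHull O_F (algebraMap K F) (S.1.comap (algebraMap K F)) (fun _ hx => S.2 hx))
  right_inv T := Subtype.ext <| comap_comapHull O_F (algebraMap K F) T.1 T.2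
  map_rel_iff' {S₁ S₂} := by
    constructor
    · intro h
      exact valuationSubring_le_of_comap_le_of_isPurelyInseparable (K := K) h
    · intro h x hx
      exact h hx

/-- **The height is unchanged in a purely inseparable extension**: a valuation ring `O_F` of a
purely inseparable extension `F/K` has the same Krull dimension (height, rank) as `O_F ∩ K`
(primes of a valuation ring ↔ overrings, `ValuationSubring.primeSpectrumOrderEquiv`, and
`overringsOrderIsoOfIsPurelyInseparable`). [folklore] -/
theorem ringKrullDim_eq_comap_of_isPurelyInseparable [IsPurelyInseparable K F]
    (O_F : ValuationSubring F) :
    ringKrullDim O_F = ringKrullDim (O_F.comap (algebraMap K F)) := by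
  have h1 := Order.krullDim_eq_of_orderIso (ValuationSubring.primeSpectrumOrderEquiv O_F)
  have h2 := Order.krullDim_eq_of_orderIso
    (ValuationSubring.primeSpectrumOrderEquiv (O_F.comap (algebraMap K F)))
  have h3 := Order.krullDim_eq_of_orderIso (overringsOrderIsoOfIsPurelyInseparable (K := K) O_F)
  rw [Order.krullDim_orderDual] at h1 h2
  unfold ringKrullDim
  rw [h1, h2, h3]

/-- In particular the height does not go up, so the replacements of Step 0 stay inside
`Temkin2013RelHeightLE n`. [folklore] -/
theorem ringKrullDim_le_comap_of_isPurelyInseparable [IsPurelyInseparable K F]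
    (O_F : ValuationSubring F) :
    ringKrullDim O_F ≤ ringKrullDim (O_F.comap (algebraMap K F)) :=
  (ringKrullDim_eq_comap_of_isPurelyInseparable O_F).le

/-- Existence of extensions of overrings (any field extension `F/K`): every overring `T` of
`O_F ∩ K` is the trace of an overring of `O_F` (constructively: its hull `comapHull`,
`CompositeValuations.lean`). [folklore] -/
theorem exists_valuationSubring_ge_comap_eq
    (O_F : ValuationSubring F) (T : ValuationSubring K) (hT : O_F.comap (algebraMap K F) ≤ T) :
    ∃ S : ValuationSubring F, O_F ≤ S ∧ S.comap (algebraMap K F) = T :=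
  ⟨comapHull O_F (algebraMap K F) T, le_comapHull O_F _ T, comap_comapHull O_F _ T hT⟩

end valuationPI

section stepZero

/-- Integrality over a subalgebra passes to any larger subalgebra (of possibly different
scalars). [folklore] -/
theorem isIntegral_of_subalgebra_le {R₁ R₂ L : Type*} [CommRing R₁] [CommRing R₂] [Field L]
    [Algebra R₁ L] [Algebra R₂ L] (S₁ : Subalgebra R₁ L) (S₂ : Subalgebra R₂ L)
    (h : S₁.toSubring ≤ S₂.toSubring) {x : L} (hx : IsIntegral S₁ x) : IsIntegral S₂ x := by
  letI : Algebra S₁ S₂ := (Subring.inclusion h).toAlgebra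
  haveI : IsScalarTower S₁ S₂ L := IsScalarTower.of_algebraMap_eq (fun _ => rfl)
  exact hx.tower_top

/-- Transitivity of integrality for subalgebras `S₁ ⊆ S₂` of a field with `S₂` integral over
`S₁`. [folklore] -/
theorem isIntegral_of_le_of_forall_isIntegral {R₁ R₂ L : Type*} [CommRing R₁] [CommRing R₂]
    [Field L] [Algebra R₁ L] [Algebra R₂ L] (S₁ : Subalgebra R₁ L) (S₂ : Subalgebra R₂ L)
    (h : S₁.toSubring ≤ S₂.toSubring) (hint : ∀ y ∈ S₂, IsIntegral S₁ y) {x : L}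
    (hx : IsIntegral S₂ x) : IsIntegral S₁ x := by
  letI : Algebra S₁ S₂ := (Subring.inclusion h).toAlgebra
  haveI : IsScalarTower S₁ S₂ L := IsScalarTower.of_algebraMap_eq (fun _ => rfl)
  haveI : Algebra.IsIntegral S₁ S₂ := ⟨fun y =>
    (isIntegral_algHom_iff (IsScalarTower.toAlgHom S₁ S₂ L) Subtype.val_injective).1 (hint y y.2)⟩
  exact isIntegral_trans x hx

variable {k K : Type u} [Field k] [Field K] [Algebra k K]

/-- **Step 0: purely inseparable extensions of `k` and `K` are harmless** (Temkin 2013, proof of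
Thm. 4.1.1, Step 0, p. 47: "if `F/K` is a finite purely inseparable extension then
`X' = Nr_F(X)` is an affine model of `F°` and for any normal affine refinement `Y' = Spec(B)` of
`X'`, the scheme `Y = Spec(B ∩ K)` is an affine refinement of `X` satisfying `Nr_F(Y) ⥲ Y'`.
[…] it suffices to prove the theorem for `F`, `X'` and `FKᵢ`'s instead of the original `K`,
`X` and `Kᵢ`'s, i.e. we can replace the field `K` with a finite purely inseparable extension
and update `X` and `Kᵢ`'s accordingly"; §4.2, Step 0, p. 50: "we can safely replace `k`, `K`
and `X` with `l`, `L` and `X'`, where `l/k` and `L/lK` are finite and purely inseparable and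
`X'` is a model of `L°` that refines `Nr_L(X)`. This is shown exactly as in Step 0 from the
proof of Theorem 4.1.1"). PROVED, in the following form: let `l₀/k` and `F/K` be finite purely
inseparable (`k → l₀ → F`, `k → K → F` compatible), `O_F` the valuation ring of `F` over
`O = K°`, `X = Spec A` an affine model of `K°` and `A_F ⊆ F` any `l₀`-subalgebra containing
the image of `A` (e.g. a model of `F°` refining `Nr_F(X)`); if the conclusion of the corrected
Thm. 1.3.2 holds for `(l₀, F, F°, Spec A_F)` then it holds for `(k, K, K°, X)`. Proof (loc.
cit., with the normalisation bypassed): given the witnesses `L/F`, `l/l₀`, `X'' = Spec A'' ⊇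
A_F`, `L°`, `N = Nr_L(A'')` over `F`, take over `K` the same `L`, `l`, `L°`, `N` and the affine
model `X' = Spec k[gens of A, b₁, …, b_m]` of `K°`, where `bⱼ ∈ K` are `qⁿ`-th powers of the
generators of `A''`; then `A''` is integral over the image of this ring and contains it, so
both have the `L`-normalisation `N`. [cite: Temkin2013, proof of Thm. 4.1.1 Step 0 (p. 47) and Section 4.2 Step 0 (p. 50)] -/
theorem Temkin2013RelConclusion.of_purelyInseparable (O : ValuationSubring K)
    (A : Subalgebra k K) (hAfg : A.FG) (hAfr : IsFractionRing A K)
    (l₀ F : Type u) [Field l₀] [Field F] [Algebra k l₀] [Algebra l₀ F] [Algebra K F]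
    [Algebra k F] [IsScalarTower k K F] [IsScalarTower k l₀ F] [FiniteDimensional k l₀]
    [IsPurelyInseparable k l₀] [FiniteDimensional K F] [IsPurelyInseparable K F]
    (O_F : ValuationSubring F) (hO_F : O_F.comap (algebraMap K F) = O)
    (A_F : Subalgebra l₀ F) (hA : ∀ a ∈ A, algebraMap K F a ∈ A_F)
    (h : Temkin2013RelConclusion l₀ F O_F A_F) : Temkin2013RelConclusion k K O A := by
  classical
  obtain ⟨L, iF, iAF, iAl, iT, hfin, hpi, l, hlfin, hlpi, A'', hA_FA'', hA''O, hA''fg, hA''fr,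
    O', hO', N, hN, hNint, hNfg, hNfr, hsm, hsep, hreg⟩ := h
  -- algebra structures on `L` over `K` and over `k`, and the towers
  letI iKL : Algebra K L := ((algebraMap F L).comp (algebraMap K F)).toAlgebra
  haveI : IsScalarTower K F L := IsScalarTower.of_algebraMap_eq fun _ => rfl
  letI ikL : Algebra k L := ((algebraMap l₀ L).comp (algebraMap k l₀)).toAlgebra
  haveI : IsScalarTower k l₀ L := IsScalarTower.of_algebraMap_eq fun _ => rfl
  haveI : IsScalarTower k F L := IsScalarTower.of_algebraMap_eq fun c => by
    show algebraMap l₀ L (algebraMap k l₀ c) = algebraMap F L (algebraMap k F c)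
    rw [IsScalarTower.algebraMap_apply k l₀ F, ← IsScalarTower.algebraMap_apply l₀ F L]
  haveI : IsScalarTower k K L := IsScalarTower.of_algebraMap_eq fun c => by
    show algebraMap k L c = algebraMap F L (algebraMap K F (algebraMap k K c))
    rw [← IsScalarTower.algebraMap_apply k K F, ← IsScalarTower.algebraMap_apply k F L]
  haveI : FiniteDimensional K L := Module.Finite.trans F L
  have hpiKL : IsPurelyInseparable K L := IsPurelyInseparable.trans K F L
  -- `qⁿ`-th powers of elements of `F` lie in `K`
  have hpow : ∀ a : F, ∃ n : ℕ, ∃ y : K, algebraMap K F y = a ^ ringExpChar K ^ n := fun a => by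
    obtain ⟨n, y, hy⟩ := IsPurelyInseparable.pow_mem K (ringExpChar K) a
    exact ⟨n, y, hy⟩
  choose n b hb using hpow
  -- generators of `A` (over `k`) and of `A''` (over `l₀`)
  obtain ⟨t, ht⟩ := hAfg
  obtain ⟨s, hs⟩ := hA''fg
  have htA : (t : Set K) ⊆ A := by rw [← ht]; exact Algebra.subset_adjoin
  have hsA'' : (s : Set F) ⊆ A'' := by rw [← hs]; exact Algebra.subset_adjoin
  -- the new affine model `X' = Spec A'` of `K°`
  set A' : Subalgebra k K := Algebra.adjoin k (↑t ∪ b '' ↑s) with hA'def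
  have hA'fg : A'.FG := by
    refine ⟨t ∪ s.image b, ?_⟩
    rw [Finset.coe_union, Finset.coe_image]
  have hAA' : A ≤ A' := by
    rw [← ht]; exact Algebra.adjoin_mono Set.subset_union_left
  have hA'A'' : ∀ x ∈ A', algebraMap K F x ∈ A'' := by
    have hle : A' ≤ (A''.restrictScalars k).comap (IsScalarTower.toAlgHom k K F) := by
      refine Algebra.adjoin_le ?_
      rintro y (hy | ⟨a, ha, rfl⟩)
      · simpa using hA_FA'' (hA y (htA hy))
      · simpa [hb] using pow_mem (hsA'' ha) (ringExpChar K ^ n a)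
    intro x hx
    simpa using hle hx
  have hA'O : A'.toSubring ≤ O.toSubring := by
    intro x hx
    have hxF : algebraMap K F x ∈ O_F := hA''O (hA'A'' x hx)
    rw [← hO_F]
    exact hxF
  have hA'fr : IsFractionRing A' K := by
    haveI := hAfr
    refine IsFractionRing.of_field A' K fun z => ?_
    obtain ⟨x, y, hy, rfl⟩ := IsFractionRing.div_surjective (A := A) z
    exact ⟨⟨x, hAA' x.2⟩, ⟨y, hAA' y.2⟩, rfl⟩
  -- the images of `A'` and `A''` in `L` have the same integral closure
  set S₁ : Subalgebra k L := A'.map (IsScalarTower.toAlgHom k K L) with hS₁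
  set S₂ : Subalgebra l₀ L := A''.map (IsScalarTower.toAlgHom l₀ F L) with hS₂
  have h12 : S₁.toSubring ≤ S₂.toSubring := by
    intro z hz
    obtain ⟨x, hx, rfl⟩ := Subalgebra.mem_map.mp hz
    exact Subalgebra.mem_map.mpr ⟨algebraMap K F x, hA'A'' x hx, rfl⟩
  have key : ∀ w ∈ Algebra.adjoin l₀ (s : Set F), IsIntegral S₁ (algebraMap F L w) := by
    intro w hw
    induction hw using Algebra.adjoin_induction with
    | mem x hx =>
      refine IsIntegral.of_pow (expChar_pow_pos K (ringExpChar K) (n x)) ?_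
      have hmem : algebraMap K L (b x) ∈ S₁ :=
        Subalgebra.mem_map.mpr ⟨b x, Algebra.subset_adjoin (Or.inr ⟨x, hx, rfl⟩), rfl⟩
      have hpw : algebraMap F L x ^ ringExpChar K ^ n x = algebraMap K L (b x) := by
        rw [← map_pow, ← hb]; rfl
      rw [hpw]
      exact isIntegral_algebraMap (x := (⟨_, hmem⟩ : S₁))
    | algebraMap r =>
      have hr : IsIntegral k r := Algebra.IsIntegral.isIntegral r
      have hr' : IsIntegral k (algebraMap l₀ L r) := hr.algebraMap
      rw [← IsScalarTower.algebraMap_apply l₀ F L]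
      exact hr'.tower_top
    | add x y _ _ hx hy => simpa only [map_add] using hx.add hy
    | mul x y _ _ hx hy => simpa only [map_mul] using hx.mul hy
  have hint : ∀ z ∈ S₂, IsIntegral S₁ z := by
    intro z hz
    obtain ⟨w, hw, rfl⟩ := Subalgebra.mem_map.mp hz
    exact key w (by rw [hs]; exact hw)
  have hNint' : (N : Set L) = {x : L | IsIntegral S₁ x} := by
    rw [hNint]
    ext x
    exact ⟨fun hx => isIntegral_of_le_of_forall_isIntegral S₁ S₂ h12 hint hx,
      fun hx => isIntegral_of_subalgebra_le S₁ S₂ h12 hx⟩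
  -- the valuation ring `L°` restricts to `K°`
  have hO'' : O'.comap (algebraMap K L) = O := by
    show O'.comap ((algebraMap F L).comp (algebraMap K F)) = O
    rw [← ValuationSubring.comap_comap, hO', hO_F]
  -- `l` as an intermediate field of `L/k`, `N` as an algebra over it
  haveI : FiniteDimensional k l := Module.Finite.trans l₀ l
  have hlpi' : IsPurelyInseparable k l := IsPurelyInseparable.trans k l₀ l
  let l' : IntermediateField k L := l.restrictScalars k
  have hlfin' : FiniteDimensional k l' := ‹FiniteDimensional k l›
  have hlpi'' : IsPurelyInseparable k l' := hlpi'
  let N' : Subalgebra l' L := N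
  -- `N` is finitely generated over `k` (it is over `l₀`, and `l₀/k` is finite)
  have hNfg' : (N'.restrictScalars k).FG := by
    have h1 : Algebra.FiniteType l₀ (N.restrictScalars l₀) :=
      (Subalgebra.fg_iff_finiteType _).mp hNfg
    have h2 : Algebra.FiniteType k (N.restrictScalars l₀) := Algebra.FiniteType.trans inferInstance h1
    have h3 : Algebra.FiniteType k (N'.restrictScalars k) := h2
    exact (Subalgebra.fg_iff_finiteType _).mpr h3
  exact ⟨L, iF, iKL, ikL, inferInstance, inferInstance, hpiKL, l', hlfin', hlpi'',
    A', hAA', hA'O, hA'fg, hA'fr, O', hO'', N', hN, hNint', hNfg', hNfr, hsm, hsep, hreg⟩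

/-- Step 0 with the ground field kept (`l₀ = k`), the form used in the proof of Thm. 4.1.1
("we can replace the field `K` with a finite purely inseparable extension and update `X`",
p. 47). [cite: Temkin2013, proof of Thm. 4.1.1 Step 0 (p. 47)] -/
theorem Temkin2013RelConclusion.of_purelyInseparable_right (O : ValuationSubring K)
    (A : Subalgebra k K) (hAfg : A.FG) (hAfr : IsFractionRing A K)
    (F : Type u) [Field F] [Algebra K F] [Algebra k F] [IsScalarTower k K F]
    [FiniteDimensional K F] [IsPurelyInseparable K F]
    (O_F : ValuationSubring F) (hO_F : O_F.comap (algebraMap K F) = O)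
    (A_F : Subalgebra k F) (hA : ∀ a ∈ A, algebraMap K F a ∈ A_F)
    (h : Temkin2013RelConclusion k F O_F A_F) : Temkin2013RelConclusion k K O A :=
  Temkin2013RelConclusion.of_purelyInseparable O A hAfg hAfr k F O_F hO_F A_F hA h

/-- **Refining the model is harmless** (Temkin 2013, §4.2 Step 0, p. 50: "Obviously, it
suffices to prove Theorem 1.3.2 for any model `X'` of `K°`" finer than `X`; proof of Thm. 4.1.1
Step 0, p. 47: "It suffices to prove the theorem for any affine model of `K°` which is finer
than `X`"): the conclusion for a finer model `A ≤ A₁` gives it for `A` (refinement is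
transitive). [cite: Temkin2013, Section 4.2 Step 0 (p. 50)] -/
theorem Temkin2013RelConclusion.of_le (O : ValuationSubring K) {A A₁ : Subalgebra k K}
    (hAA₁ : A ≤ A₁) (h : Temkin2013RelConclusion k K O A₁) : Temkin2013RelConclusion k K O A := by
  obtain ⟨L, iF, iA, iAk, iT, hfin, hpi, l, hlfin, hlpi, A', hA₁A', rest⟩ := h
  exact ⟨L, iF, iA, iAk, iT, hfin, hpi, l, hlfin, hlpi, A', hAA₁.trans hA₁A', rest⟩

end stepZero

end Literature.AlgebraicGeometry.Resolution

end
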